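import Mathlib
import Summits.Ventures.PercRepro2.MixChordA3

/-!
# The existential forms of (MIX-CHORD) (blind cell PercRepro2, night-1 g19; NIGHT1-G19.md §8)

The inductions of `MixChord.lean` and `MixChordA3.lean` use the mixed chord along ONE edge per
step; the rows they need are therefore the existential ones:

* **`MixChordExists p`**: if some root edge is fractional, SOME root edge satisfies the mixed chord
  (the repair of mine-a's (EXISTS-CHORD) in its original existential shape);
* **`MixChordA3Exists p`**: if some fractional edge touches the weight-`1` cluster of `a₃`, some such
  edge satisfies the mixed chord.

`HCov_all_of_mixChordExists_all`, `HCov_all_of_mixChordA3Exists_all`: either row on all instances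
gives the crux; the «for every edge» rows imply them (`mixChordExists_of_mixChord`).

Own code; standard axioms.
-/

namespace Summit.Ventures.PercRepro2

open UnionCluster CovForm

namespace Mix

open scoped Classical

section Defs

variable {V : Type*} {E : Type*} [Fintype E] [DecidableEq E] {R : Type*} [Field R]
  [LinearOrder R]

/-- **(MIX-CHORD, ∃)** at `p`: some root edge satisfies the mixed chord. -/
def MixChordExists (p : E → R) (ends : E → Sym2 V) (o a₁ a₂ a₃ b : V) : Prop :=
  (Chord.rootEdges p ends a₁ a₂).Nonempty →
    ∃ e ∈ Chord.rootEdges p ends a₁ a₂,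
      p e * Gc (Function.update p e 1) ends o a₁ a₂ a₃ b +
        (1 - p e) * (shrink p ends a₁ a₂ a₃ e * Gc (Function.update p e 0) ends o a₁ a₂ a₃ b) ≤
          Gc p ends o a₁ a₂ a₃ b

/-- **(MIX-CHORD-A3, ∃)** at `p`: some fractional edge at `S₃` satisfies the mixed chord. -/
def MixChordA3Exists (p : E → R) (ends : E → Sym2 V) (o a₁ a₂ a₃ b : V) : Prop :=
  (a3Edges p ends a₃).Nonempty →
    ∃ e ∈ a3Edges p ends a₃,
      p e * Gc (Function.update p e 1) ends o a₁ a₂ a₃ b +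
        (1 - p e) * (shrink p ends a₁ a₂ a₃ e * Gc (Function.update p e 0) ends o a₁ a₂ a₃ b) ≤
          Gc p ends o a₁ a₂ a₃ b

/-- The «for every root edge» row gives the existential one. -/
theorem mixChordExists_of_mixChord {p : E → R} {ends : E → Sym2 V} {o a₁ a₂ a₃ b : V}
    (h : MixChord p ends o a₁ a₂ a₃ b) : MixChordExists p ends o a₁ a₂ a₃ b := fun hne =>
  ⟨hne.choose, hne.choose_spec, h _ hne.choose_spec⟩

/-- The «for every edge at `S₃`» row gives the existential one. -/
theorem mixChordA3Exists_of_mixChordA3 {p : E → R} {ends : E → Sym2 V} {o a₁ a₂ a₃ b : V}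
    (h : MixChordA3 p ends o a₁ a₂ a₃ b) : MixChordA3Exists p ends o a₁ a₂ a₃ b := fun hne =>
  ⟨hne.choose, hne.choose_spec, h _ hne.choose_spec⟩

end Defs

section All

variable (R : Type*) [Field R] [LinearOrder R] [IsStrictOrderedRing R]

/-- Row (MIX-CHORD, ∃) over all instances. -/
def MixChordExists_all : Prop :=
  ∀ (V E : Type) [Fintype V] [DecidableEq V] [Fintype E] [DecidableEq E]
    (ends : E → Sym2 V) (p : E → R), IsProbVec p →
    ∀ o a₁ a₂ a₃ b : V, a₁ ≠ a₂ → a₁ ≠ a₃ → a₂ ≠ a₃ → o ≠ a₁ → o ≠ a₂ → o ≠ a₃ → o ≠ b →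
      b ≠ a₁ → b ≠ a₂ → b ≠ a₃ → MixChordExists p ends o a₁ a₂ a₃ b

/-- Row (MIX-CHORD-A3, ∃) over all instances. -/
def MixChordA3Exists_all : Prop :=
  ∀ (V E : Type) [Fintype V] [DecidableEq V] [Fintype E] [DecidableEq E]
    (ends : E → Sym2 V) (p : E → R), IsProbVec p →
    ∀ o a₁ a₂ a₃ b : V, a₁ ≠ a₂ → a₁ ≠ a₃ → a₂ ≠ a₃ → o ≠ a₁ → o ≠ a₂ → o ≠ a₃ → o ≠ b →
      b ≠ a₁ → b ≠ a₂ → b ≠ a₃ → MixChordA3Exists p ends o a₁ a₂ a₃ b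

end All

section Induction

variable {V : Type*} {E : Type*} [Fintype E] [DecidableEq E] [Fintype V] [DecidableEq V]
  {R : Type*} [Field R] [LinearOrder R] [IsStrictOrderedRing R]

omit [Fintype V] [DecidableEq V] in
/-- **(MIX-CHORD, ∃) ⟹ `Gc ≥ 0`** (strong induction on the fractional edges). -/
theorem Gc_nonneg_of_mixChordExists (ends : E → Sym2 V) (o a₁ a₂ a₃ b : V)
    (hmix : ∀ q : E → R, IsProbVec q → MixChordExists q ends o a₁ a₂ a₃ b) :
    ∀ (n : ℕ) (p : E → R), IsProbVec p → (Chord.frac p).card = n →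
      0 ≤ Gc p ends o a₁ a₂ a₃ b := by
  intro n
  induction n using Nat.strong_induction_on with
  | _ n ih =>
  intro p hp hn
  by_cases h0 : Chord.rootEdges p ends a₁ a₂ = ∅
  · rw [Chord.Gc_eq_zero_of_rootEdges_empty h0]
  · obtain ⟨e, he, hle⟩ := hmix p hp (Finset.nonempty_iff_ne_empty.2 h0)
    have hf := Chord.frac_of_mem_rootEdges he
    have hlt : ((Chord.frac p).erase e).card < n := by
      rw [← hn]
      exact Finset.card_erase_lt_of_mem hf
    have h1 := ih _ hlt _ (hp.update e zero_le_one le_rfl) (by rw [Chord.frac_update_one hf])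
    have h2 := ih _ hlt _ (hp.update e le_rfl zero_le_one) (by rw [Chord.frac_update_zero hf])
    exact (add_nonneg (mul_nonneg (hp.nonneg e) h1)
      (mul_nonneg (sub_nonneg.2 (hp.le_one e)) (mul_nonneg (shrink_nonneg hp ends a₁ a₂ a₃ e) h2))).trans hle

/-- **(MIX-CHORD-A3, ∃) ⟹ `Gc ≥ 0`**: the base `Gc_nonneg_of_no_a3Edge`. -/
theorem Gc_nonneg_of_mixChordA3Exists (ends : E → Sym2 V) (o a₁ a₂ a₃ b : V)
    (hmix : ∀ q : E → R, IsProbVec q → MixChordA3Exists q ends o a₁ a₂ a₃ b) :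
    ∀ (n : ℕ) (p : E → R), IsProbVec p → (Chord.frac p).card = n →
      0 ≤ Gc p ends o a₁ a₂ a₃ b := by
  intro n
  induction n using Nat.strong_induction_on with
  | _ n ih =>
  intro p hp hn
  by_cases h0 : a3Edges p ends a₃ = ∅
  · exact Gc_nonneg_of_no_a3Edge hp h0 o b
  · obtain ⟨e, he, hle⟩ := hmix p hp (Finset.nonempty_iff_ne_empty.2 h0)
    have hf : e ∈ Chord.frac p := by
      simp only [a3Edges, Finset.mem_filter] at he
      exact he.1
    have hlt : ((Chord.frac p).erase e).card < n := by
      rw [← hn]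
      exact Finset.card_erase_lt_of_mem hf
    have h1 := ih _ hlt _ (hp.update e zero_le_one le_rfl) (by rw [Chord.frac_update_one hf])
    have h2 := ih _ hlt _ (hp.update e le_rfl zero_le_one) (by rw [Chord.frac_update_zero hf])
    exact (add_nonneg (mul_nonneg (hp.nonneg e) h1)
      (mul_nonneg (sub_nonneg.2 (hp.le_one e)) (mul_nonneg (shrink_nonneg hp ends a₁ a₂ a₃ e) h2))).trans hle

end Induction

section ChainAll

variable (R : Type*) [Field R] [LinearOrder R] [IsStrictOrderedRing R]

/-- **(MIX-CHORD, ∃) on all instances ⟹ the crux.** -/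
theorem HCov_all_of_mixChordExists_all (h : MixChordExists_all R) : HCov_all R := by
  intro V E _ _ _ _ ends p hp o a₁ a₂ a₃ b h12 h13 h23 ho1 ho2 ho3 hob hb1 hb2 hb3
  exact Gc_nonneg_of_mixChordExists ends o a₁ a₂ a₃ b
    (fun q hq => h V E ends q hq o a₁ a₂ a₃ b h12 h13 h23 ho1 ho2 ho3 hob hb1 hb2 hb3) _ p hp rfl

/-- **(MIX-CHORD-A3, ∃) on all instances ⟹ the crux.** -/
theorem HCov_all_of_mixChordA3Exists_all (h : MixChordA3Exists_all R) : HCov_all R := by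
  intro V E _ _ _ _ ends p hp o a₁ a₂ a₃ b h12 h13 h23 ho1 ho2 ho3 hob hb1 hb2 hb3
  exact Gc_nonneg_of_mixChordA3Exists ends o a₁ a₂ a₃ b
    (fun q hq => h V E ends q hq o a₁ a₂ a₃ b h12 h13 h23 ho1 ho2 ho3 hob hb1 hb2 hb3) _ p hp rfl

end ChainAll

end Mix

end Summit.Ventures.PercRepro2
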